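import Literature.NumberTheory.LFunctions.WeilTwoPrimeCells
import HarnessLib

/-!
# RiemannHypothesis / GroundBarta machinery — LATTICE RIPPLES (1/2): one ripple `A cos(t·(j log 2 + k log 3))` and its
cell-local polynomial minorant

Helper file (`--supports stmt-RiemannHypothesis-18085`; infrastructure for the Weil-positivity ladder), RH-free, axioms
standard.  Seat rh-explicit-weil-1 (memo `run/shared/lean/pub/rh-explicit/rh-explicit-weil-1/WEIL1-SIZELAW.md`).

Purpose.  By the phantom-ripple identity (`…PhantomRipples.lean`: `∫ |ĝ(1/2+it)|² · 2cos(tx) dt = 0` for `tsupport g ⊆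
[-c,c]`, `|x| ≥ 2c`) the frequency weight `w₂₃` of the two-prime form `E₂₃` may be replaced by `w₂₃ + P` for any cosine sum
`P` with frequencies `≥ 2c` — in particular the HARMONICS `cos(j t log 2)`, `j log 2 ≥ 2c`, and `cos(k t log 3)`, `k log 3 ≥ 2c`
—, which raises the tail level `inf_{|t| ≥ T} (w₂₃ + P)` of the moment certificates (`CellsOK₂₃.level`) by `≈ 0.9` and so divides
`T` (hence `N ≈ e·a₀·T`) by `≈ 2.5–3`.  On the body `[0, T]` the certificate then needs a certified minorant of `w₂₃ + P`; this
file supplies the `P`-half as an ADDITIVE layer of data-driven cells, by the same mechanism as the prime-`3` ripple of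
`TPDCell` (`WeilTwoPrimeCells.lean`: endpoint constants from the fixed-point engine `FI` + signed Maclaurin brackets):

* `XClaim` — one ripple `A cos(t x)`, `x = j log 2 + k log 3`, with CLAIMED rationals `xlo ≤ x ≤ xhi`, `alo ≤ A cos(u x)`,
  `blo ≤ −A sin(u x)` (checked against the engine: `XClaim.freqFI`, `XClaim.alphaLoQ`, `XClaim.betaLoQ`) and the bracket order `n`;
  its polynomial `XClaim.poly` in `h = t − u` minorises `A cos(t x)` on the cell (`XClaim.polyR_poly_le_of`);
* (file 2/2, `…LatticeRippleCells.lean`) `XCell` — an interval `[u, v]` with a list of claims, its checker, soundness,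
  sup bound, exact moments and the validity predicate for the chain layer.

Everything here is proved; no named facts.  The frequency data `(j, k)` are integers, so the engine encloses
`x = j log 2 + k log 3` from its own `log 2`, `log 3` (`logTwoFI`, `logThreeFI`); `0 ≤ xlo` is required (flip `(j,k) ↦ (−j,−k)`,
`cos` is even).
-/

set_option linter.dupNamespace false

noncomputable section

open Complex Finset MeasureTheory Set Filter
open scoped Real Topology BigOperators

namespace Summit.RiemannHypothesis.RiemannHypothesis.Theorems.EvenWinsBeyondArch

open Literature.NumberTheory.LFunctions
open Literature.Analysis.ValidatedNumerics.Numerics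
open Literature.Analysis.SpecialFunctions

/-! ## One ripple with its claims -/

/-- One lattice ripple `A cos(t x)`, `x = j log 2 + k log 3`, with the cell-local CLAIMS: bracket order `n`, a rational
enclosure `xlo ≤ x ≤ xhi`, and lower bounds `alo ≤ A cos(u x)`, `blo ≤ −A sin(u x)` at the left end point `u` of the cell
(all verified against the engine by `XCell.checkZ`). [folklore] -/
structure XClaim where
  /-- multiplicity of `log 2` in the frequency -/
  j : ℤ
  /-- multiplicity of `log 3` in the frequency -/
  k : ℤ
  /-- the (signed) amplitude -/
  A : ℚ
  /-- order of the Maclaurin brackets of `cos(hx)`, `sin(hx)` -/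
  n : ℕ
  /-- claimed rational lower end for `x` -/
  xlo : ℚ
  /-- claimed rational upper end for `x` -/
  xhi : ℚ
  /-- claimed lower bound of `A cos(u x)` -/
  alo : ℚ
  /-- claimed lower bound of `−A sin(u x)` -/
  blo : ℚ

namespace XClaim

variable (r : XClaim)

/-- The frequency `x = j log 2 + k log 3`. [folklore] -/
def freq : ℝ := (r.j : ℝ) * Real.log 2 + (r.k : ℝ) * Real.log 3

/-- The ripple `A cos(t x)`. [folklore] -/
def val (t : ℝ) : ℝ := (r.A : ℝ) * Real.cos (t * r.freq)

/-- Engine enclosure of the frequency. [folklore] -/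
def freqFI : FI := FI.add (FI.mulInt logTwoFI r.j) (FI.mulInt logThreeFI r.k)

/-- `x ∈ freqFI`. [folklore] -/
theorem mem_freqFI : FI.mem r.freq r.freqFI := by
  have h := FI.mem_add (FI.mem_mulInt mem_logTwoFI r.j) (FI.mem_mulInt mem_logThreeFI r.k)
  have e : Real.log 2 * (r.j : ℝ) + Real.log 3 * (r.k : ℝ) = r.freq := by unfold freq; ring
  rw [e] at h
  exact h

/-- `u · x` as an interval, for a rational `u`. [folklore] -/
def thetaFI (u : ℚ) : FI := FI.mul (FI.ofRat u) r.freqFI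

/-- `u x ∈ thetaFI u`. [folklore] -/
theorem mem_thetaFI (u : ℚ) : FI.mem ((u : ℝ) * r.freq) (r.thetaFI u) :=
  FI.mem_mul (FI.mem_ofRat u) r.mem_freqFI

/-- Engine rational `≤ A cos(u x)`. [folklore] -/
def alphaLoQ (u : ℚ) : ℚ := (FI.mul (FI.ofRat r.A) (FI.cosSin (r.thetaFI u)).1).loQ

/-- Engine rational `≤ −A sin(u x)`. [folklore] -/
def betaLoQ (u : ℚ) : ℚ := (FI.neg (FI.mul (FI.ofRat r.A) (FI.cosSin (r.thetaFI u)).2)).loQ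

/-- `alphaLoQ u ≤ A cos(u x)`. [folklore] -/
theorem alphaLoQ_le (u : ℚ) : (r.alphaLoQ u : ℝ) ≤ (r.A : ℝ) * Real.cos ((u : ℝ) * r.freq) :=
  FI.loQ_le (FI.mem_mul (FI.mem_ofRat r.A) (FI.mem_cosSin (r.mem_thetaFI u)).1)

/-- `betaLoQ u ≤ −A sin(u x)`. [folklore] -/
theorem betaLoQ_le (u : ℚ) : (r.betaLoQ u : ℝ) ≤ -((r.A : ℝ) * Real.sin ((u : ℝ) * r.freq)) :=
  FI.loQ_le (FI.mem_neg (FI.mem_mul (FI.mem_ofRat r.A) (FI.mem_cosSin (r.mem_thetaFI u)).2))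

/-- The bracket of `cos(hx)` used with the sign of `alo`. [folklore] -/
def cosBracket : List ℚ :=
  if 0 ≤ r.alo then cosLoCoeffs r.xlo r.xhi r.n else cosUpCoeffs r.xlo r.xhi r.n

/-- The bracket of `sin(hx)` used with the sign of `blo`. [folklore] -/
def sinBracket : List ℚ :=
  if 0 ≤ r.blo then sinLoCoeffs r.xlo r.xhi r.n else sinUpCoeffs r.xlo r.xhi r.n

/-- The ripple polynomial: coefficients of `h^i`, `h = t − u`, of `alo · (cos bracket) + blo · (sin bracket)`. [folklore] -/
def poly : List ℚ :=
  tabV (r.n + 1) fun i ↦ r.alo * getV r.cosBracket i + r.blo * getV r.sinBracket i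

/-- Lengths of the brackets. [folklore] -/
theorem length_cosBracket : r.cosBracket.length = r.n + 1 := by
  unfold cosBracket cosLoCoeffs cosUpCoeffs; split_ifs <;> simp [tabV]

/-- Lengths of the brackets. [folklore] -/
theorem length_sinBracket : r.sinBracket.length = r.n + 1 := by
  unfold sinBracket sinLoCoeffs sinUpCoeffs; split_ifs <;> simp [tabV]

/-- Length of the ripple polynomial. [folklore] -/
theorem length_poly : r.poly.length = r.n + 1 := by simp [poly, tabV]

/-- `poly(h) = alo · (cos bracket)(h) + blo · (sin bracket)(h)`. [folklore] -/
theorem polyR_poly (h : ℝ) :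
    polyR r.poly h = (r.alo : ℝ) * polyR r.cosBracket h + (r.blo : ℝ) * polyR r.sinBracket h := by
  unfold poly
  rw [polyR_tabV]
  unfold polyR
  rw [length_cosBracket, length_sinBracket, Finset.mul_sum, Finset.mul_sum, ← Finset.sum_add_distrib]
  refine Finset.sum_congr rfl fun i _ ↦ ?_
  push_cast
  ring

/-- The checks of one claim on the cell `[u, v]`: `n ≥ 1`, `0 ≤ xlo`, `(v − u) · xhi ≤ 1`, and the claimed constants
against the engine. [folklore] -/
def check (u v : ℚ) : Bool :=
  decide (0 < r.n) && decide (0 ≤ r.xlo) && decide ((v - u) * r.xhi ≤ 1) &&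
    decide (r.xlo ≤ r.freqFI.loQ) && decide (r.freqFI.hiQ ≤ r.xhi) &&
    decide (r.alo ≤ r.alphaLoQ u) && decide (r.blo ≤ r.betaLoQ u)

variable {r}

/-- Unpacking `check`. [folklore] -/
theorem check_spec {u v : ℚ} (h : r.check u v = true) :
    0 < r.n ∧ 0 ≤ r.xlo ∧ (v - u) * r.xhi ≤ 1 ∧ r.xlo ≤ r.freqFI.loQ ∧ r.freqFI.hiQ ≤ r.xhi ∧
      r.alo ≤ r.alphaLoQ u ∧ r.blo ≤ r.betaLoQ u := by
  unfold check at h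
  simp only [Bool.and_eq_true, decide_eq_true_eq] at h
  exact ⟨h.1.1.1.1.1.1, h.1.1.1.1.1.2, h.1.1.1.1.2, h.1.1.1.2, h.1.1.2, h.1.2, h.2⟩

/-- **One-ripple soundness.** On `[u, v]`, `poly(t − u) ≤ A cos(t x)` (addition formula at `u`, signed Maclaurin brackets
of `cos(hx)`, `sin(hx)` on `0 ≤ hx ≤ 1`). [folklore] -/
theorem polyR_poly_le_of {u v : ℚ} (hn : 0 < r.n) (hx0q : 0 ≤ r.xlo) (hwq : (v - u) * r.xhi ≤ 1)
    (hxloq : r.xlo ≤ r.freqFI.loQ) (hxhiq : r.freqFI.hiQ ≤ r.xhi) (haq : r.alo ≤ r.alphaLoQ u)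
    (hbq : r.blo ≤ r.betaLoQ u) {t : ℝ} (hut : (u : ℝ) ≤ t) (htv : t ≤ (v : ℝ)) :
    polyR r.poly (t - u) ≤ r.val t := by
  set L : ℝ := r.freq with hLdef
  set hh : ℝ := t - u with hhdef
  have hx0 : (0 : ℝ) ≤ r.xlo := by exact_mod_cast hx0q
  have hL1 : (r.xlo : ℝ) ≤ L := le_trans (by exact_mod_cast hxloq) (FI.loQ_le r.mem_freqFI)
  have hL2 : L ≤ (r.xhi : ℝ) := le_trans (FI.le_hiQ r.mem_freqFI) (by exact_mod_cast hxhiq)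
  have hLnn : 0 ≤ L := hx0.trans hL1
  have hh0 : 0 ≤ hh := by rw [hhdef]; linarith
  have hhw : hh ≤ (v : ℝ) - u := by rw [hhdef]; linarith
  have hhL : hh * L ≤ 1 := by
    have h1 : hh * L ≤ ((v : ℝ) - u) * r.xhi := mul_le_mul hhw hL2 hLnn (by linarith)
    have h2 : ((v : ℝ) - u) * r.xhi ≤ 1 := by exact_mod_cast hwq
    linarith
  have hy0 : 0 ≤ hh * L := mul_nonneg hh0 hLnn
  have hcos0 : 0 ≤ Real.cos (hh * L) :=
    Real.cos_nonneg_of_mem_Icc ⟨by linarith [Real.pi_pos], by linarith [Real.pi_gt_three]⟩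
  have hsin0 : 0 ≤ Real.sin (hh * L) :=
    Real.sin_nonneg_of_nonneg_of_le_pi hy0 (by linarith [Real.pi_gt_three])
  set α : ℝ := (r.A : ℝ) * Real.cos ((u : ℝ) * L) with hαdef
  set β : ℝ := -((r.A : ℝ) * Real.sin ((u : ℝ) * L)) with hβdef
  have hadd : r.val t = α * Real.cos (hh * L) + β * Real.sin (hh * L) := by
    unfold val
    have : t * r.freq = (u : ℝ) * L + hh * L := by rw [hhdef, hLdef]; ring
    rw [this, Real.cos_add, hαdef, hβdef]
    ring
  have ha : (r.alo : ℝ) ≤ α := by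
    rw [hαdef, hLdef]; exact le_trans (by exact_mod_cast haq) (r.alphaLoQ_le u)
  have hb : (r.blo : ℝ) ≤ β := by
    rw [hβdef, hLdef]; exact le_trans (by exact_mod_cast hbq) (r.betaLoQ_le u)
  rw [hadd, polyR_poly]
  refine add_le_add ?_ ?_
  · unfold cosBracket
    split_ifs with hsgn
    · have h0 : (0 : ℝ) ≤ r.alo := by exact_mod_cast hsgn
      calc (r.alo : ℝ) * polyR (cosLoCoeffs r.xlo r.xhi r.n) hh
          ≤ (r.alo : ℝ) * Real.cos (hh * L) :=
            mul_le_mul_of_nonneg_left (polyR_cosLo_le hx0 hL1 hL2 hh0 hhL hn) h0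
        _ ≤ α * Real.cos (hh * L) := mul_le_mul_of_nonneg_right ha hcos0
    · push Not at hsgn
      have h0 : (r.alo : ℝ) ≤ 0 := by exact_mod_cast hsgn.le
      calc (r.alo : ℝ) * polyR (cosUpCoeffs r.xlo r.xhi r.n) hh
          ≤ (r.alo : ℝ) * Real.cos (hh * L) :=
            mul_le_mul_of_nonpos_left (cos_le_polyR_cosUp hx0 hL1 hL2 hh0 hhL hn) h0
        _ ≤ α * Real.cos (hh * L) := mul_le_mul_of_nonneg_right ha hcos0
  · unfold sinBracket
    split_ifs with hsgn
    · have h0 : (0 : ℝ) ≤ r.blo := by exact_mod_cast hsgn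
      calc (r.blo : ℝ) * polyR (sinLoCoeffs r.xlo r.xhi r.n) hh
          ≤ (r.blo : ℝ) * Real.sin (hh * L) :=
            mul_le_mul_of_nonneg_left (polyR_sinLo_le hx0 hL1 hL2 hh0 hhL hn) h0
        _ ≤ β * Real.sin (hh * L) := mul_le_mul_of_nonneg_right hb hsin0
    · push Not at hsgn
      have h0 : (r.blo : ℝ) ≤ 0 := by exact_mod_cast hsgn.le
      calc (r.blo : ℝ) * polyR (sinUpCoeffs r.xlo r.xhi r.n) hh
          ≤ (r.blo : ℝ) * Real.sin (hh * L) :=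
            mul_le_mul_of_nonpos_left (sin_le_polyR_sinUp hx0 hL1 hL2 hh0 hhL hn) h0
        _ ≤ β * Real.sin (hh * L) := mul_le_mul_of_nonneg_right hb hsin0

/-- One-ripple soundness from the checker. [folklore] -/
theorem polyR_poly_le_of_check {u v : ℚ} (h : r.check u v = true) {t : ℝ} (hut : (u : ℝ) ≤ t)
    (htv : t ≤ (v : ℝ)) : polyR r.poly (t - u) ≤ r.val t := by
  obtain ⟨hn, hx0, hw, hxlo, hxhi, ha, hb⟩ := check_spec h
  exact polyR_poly_le_of hn hx0 hw hxlo hxhi ha hb hut htv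

/-- `Σ_i |p_i| w^i`, an upper bound of `|poly|` on `[0, w]`. [folklore] -/
def absQ (r : XClaim) (w : ℚ) : ℚ := sumR (r.n + 1) fun i ↦ |getV r.poly i| * w ^ i

/-- Cast of `absQ`. [folklore] -/
theorem absQ_cast (r : XClaim) (w : ℚ) :
    ((r.absQ w : ℚ) : ℝ) = ∑ i ∈ Finset.range (r.n + 1), |((getV r.poly i : ℚ) : ℝ)| * (w : ℝ) ^ i := by
  unfold absQ; rw [sumR_eq_sum]; push_cast; rfl

/-- `|poly(h)| ≤ absQ w` for `0 ≤ h ≤ w`. [folklore] -/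
theorem abs_polyR_poly_le (r : XClaim) {h : ℝ} {w : ℚ} (h0 : 0 ≤ h) (hw : h ≤ (w : ℝ)) :
    |polyR r.poly h| ≤ ((r.absQ w : ℚ) : ℝ) := by
  have := abs_polyR_le r.poly h0 hw
  rw [length_poly] at this
  rw [absQ_cast]
  exact this

/-- `0 ≤ absQ w` for `0 ≤ w`. [folklore] -/
theorem absQ_nonneg (r : XClaim) {w : ℚ} (hw : 0 ≤ w) : 0 ≤ r.absQ w := by
  unfold absQ; rw [sumR_eq_sum]
  exact Finset.sum_nonneg fun i _ ↦ mul_nonneg (abs_nonneg _) (pow_nonneg hw _)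

end XClaim

end Summit.RiemannHypothesis.RiemannHypothesis.Theorems.EvenWinsBeyondArch

end
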